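import Mathlib.GroupTheory.SpecificGroups.Quaternion
import Mathlib.Data.Finset.Sort
import Summits.MatrixMultiplication.OmegaCensus.IndepSetSearch
import Summits.MatrixMultiplication.OmegaCensus.BoxIndependence

/-!
# ω-census, family (b3): the `Dic₃` boxes — enumeration of `Dic₃ = QuaternionGroup 3`, cell coding, and the two glue theorems

HONEST FRAMING (pub-omega census; verbatim): lottery ticket; floor = certified bounds/negative ranges.
Census BOOKKEEPING — definitions and glue for `Dic3BoxIndependence.lean` (the kernel form of the tpp lane's machine constant
`α_{Dic₃}(12,3,3) = 20` of `ProductBoxBound.lean`, which excludes the census cell `(34,3,3)` in `Dic₃ × C₁₅`); no value of `ω` here.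
Parallel to `S3BoxData.lean` / `S3BoxIndependence.lean` (the `S₃` boxes, constant `10`), with two differences forced by size
(`108`-vertex conflict graphs, independence number `20`, eleven of the `33` box classes with a fractional clique-cover bound `≥ 21`):

* the graph side is a CERTIFICATE (`IndepSetCert.Cert`, checked in pieces and composed as plain statements "every
  `adj`-independent set of naturals `< 108` inside the mask `P` has `< k` elements" — `IndepSearch.NoIndep` of `IndepSetCertFast.lean`,
  written out here so that this file depends on `IndepSetSearch.lean` only) instead of one in-kernel search, and
* for the hardest classes the glue first uses the free right-translation symmetry of the first coordinate
  (`cellWord (x g, y, w) (x' g, y', w') = cellWord (x, y, w) (x', y', w')`, any group): an independent set either avoids the twelve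
  cells over one pair `(y₀, w₀)` (`boxOK_of_orbit`, hypothesis `hA`), or — after translating — contains the cell `(1, y₀, w₀)` and then
  lies, apart from that cell, among its non-neighbours (hypothesis `hB`, bound `20 - 1`).

Contents: `el` / `ix` (`Dic₃` as the naturals `0 … 11`: `i ↦ a i` for `i < 6`, `6 + i ↦ xa i`), `cellOf` / `code` (cells of a box
`Dic₃ × Y × W`, `|Y| = |W| = 3`, as naturals `< 108`: `9·ix x + 3·pos y + pos w`), `adjOK` (an adjacency table is sound for the group:
every flagged pair interacts), `fibreMask`, and the glue theorems `boxOK_of_root`, `boxOK_of_orbit` producing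
`BoxIndep.BoxOK 20 univ Y W` from such facts about a sound table.  Also `BoxOK.of_mulEquiv` (transport under a group
automorphism, any group) and the outer automorphism `psi` of `Dic₃` used by the class table of `Dic3BoxIndependence.lean`.
-/

open Finset
open Summit.MatrixMultiplication.OmegaCensus.ProductBoxBound
open Summit.MatrixMultiplication.OmegaCensus.IndepSearch
open Summit.MatrixMultiplication.OmegaCensus.BoxIndep

namespace Summit.MatrixMultiplication.OmegaCensus.Dic3Box

/-! ## `Dic₃ = QuaternionGroup 3`: elements as naturals -/

/-- The group of the boxes: the dicyclic group of order `12`, in Mathlib's model `QuaternionGroup 3`. [folklore] -/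
abbrev Q := QuaternionGroup 3

/-- Enumeration of `Dic₃`: `i ↦ a i` for `i < 6`, `6 + i ↦ xa i` (junk `xa 5` above `11`). [folklore] -/
def el : ℕ → Q
  | 0 => QuaternionGroup.a 0
  | 1 => QuaternionGroup.a 1
  | 2 => QuaternionGroup.a 2
  | 3 => QuaternionGroup.a 3
  | 4 => QuaternionGroup.a 4
  | 5 => QuaternionGroup.a 5
  | 6 => QuaternionGroup.xa 0
  | 7 => QuaternionGroup.xa 1
  | 8 => QuaternionGroup.xa 2
  | 9 => QuaternionGroup.xa 3
  | 10 => QuaternionGroup.xa 4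
  | _ => QuaternionGroup.xa 5

/-- The index of an element of `Dic₃` (inverse of `el`). [folklore] -/
def ix : Q → ℕ
  | QuaternionGroup.a i => i.val
  | QuaternionGroup.xa i => 6 + i.val

/-- `ix` takes values `< 12`. [folklore] -/
theorem ix_lt (q : Q) : ix q < 12 := by revert q; decide

/-- `el` inverts `ix`. [folklore] -/
theorem el_ix (q : Q) : el (ix q) = q := by revert q; decide

/-- `ix` inverts `el` below `12`. [folklore] -/
theorem ix_el : ∀ i < 12, ix (el i) = i := by decide

/-- `ix` is injective. [folklore] -/
theorem ix_injective : Function.Injective ix := fun a b h => by rw [← el_ix a, ← el_ix b, h]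

/-- The identity has index `0`. [folklore] -/
theorem ix_one : ix 1 = 0 := by decide

/-! ## Cells of a box as naturals `< 108`, sound adjacency tables -/

/-- The cell coded by `c < 108` in the box with coordinate index lists `Yl`, `Wl`: `(el (c / 9), el Yl[c / 3 % 3], el Wl[c % 3])`.
[folklore] -/
def cellOf (Yl Wl : List ℕ) (c : ℕ) : Q × Q × Q := (el (c / 9), el (Yl.getD (c / 3 % 3) 0), el (Wl.getD (c % 3) 0))

/-- The code of a cell of the box `(Yl, Wl)`: `9·ix x + 3·pos y + pos w`. [folklore] -/
def code (Yl Wl : List ℕ) (P : Q × Q × Q) : ℕ := 9 * ix P.1 + 3 * Yl.idxOf (ix P.2.1) + Wl.idxOf (ix P.2.2)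

/-- Soundness check of an adjacency table against the group: every flagged pair `(c, c')` is a pair of DISTINCT codes whose cells
interact (`cellWord = 1` in one of the two orders).  Only this direction is needed. [folklore] -/
def adjOK (Yl Wl : List ℕ) (adj : ℕ → ℕ) : Bool :=
  (List.range 108).all fun c => (List.range 108).all fun c' =>
    !(adj c).testBit c' || (!(c == c') &&
      (decide (cellWord (cellOf Yl Wl c) (cellOf Yl Wl c') = 1) || decide (cellWord (cellOf Yl Wl c') (cellOf Yl Wl c) = 1)))

/-- Reading `adjOK`. [folklore] -/
theorem interact_of_adjOK {Yl Wl : List ℕ} {adj : ℕ → ℕ} (h : adjOK Yl Wl adj = true) {c c' : ℕ} (hc : c < 108) (hc' : c' < 108)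
    (ht : (adj c).testBit c' = true) :
    c ≠ c' ∧ (cellWord (cellOf Yl Wl c) (cellOf Yl Wl c') = 1 ∨ cellWord (cellOf Yl Wl c') (cellOf Yl Wl c) = 1) := by
  simp only [adjOK, List.all_eq_true, List.mem_range, Bool.or_eq_true, Bool.and_eq_true,
    decide_eq_true_eq, ne_eq, Bool.not_eq_eq_eq_not, Bool.not_true, beq_eq_false_iff_ne] at h
  rcases h c hc c' hc' with h | h
  · rw [ht] at h; exact absurd h (by decide)
  · exact h

/-- The mask of the twelve codes `9x + j` (`x < 12`) of the cells over the pair of positions `j = 3·pos y + pos w`. [folklore] -/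
def fibreMask (j : ℕ) : ℕ := (List.range 12).foldr (fun x acc => acc ||| 2 ^ (9 * x + j)) 0

/-- Membership in `fibreMask j` (`j < 9`) for codes `a < 108` is `a % 9 = j`. [folklore] -/
theorem testBit_fibreMask : ∀ j < 9, ∀ a < 108, (fibreMask j).testBit a = decide (a % 9 = j) := by decide

section Coding

variable {Yl Wl : List ℕ} (hYl : Yl.length = 3) (hWl : Wl.length = 3) (hY : ∀ a ∈ Yl, a < 12) (hW : ∀ a ∈ Wl, a < 12)
include hYl hWl hY hW

/-- Decoding: a cell of the box has code `< 108`, and `cellOf` recovers it. [folklore] -/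
theorem code_lt_and_cellOf_code {P : Q × Q × Q} (hP : P ∈ (univ : Finset Q) ×ˢ ((Yl.map el).toFinset ×ˢ (Wl.map el).toFinset)) :
    code Yl Wl P < 108 ∧ cellOf Yl Wl (code Yl Wl P) = P ∧ code Yl Wl P % 9 = 3 * Yl.idxOf (ix P.2.1) + Wl.idxOf (ix P.2.2) := by
  obtain ⟨x, y, w⟩ := P
  simp only [mem_product, mem_univ, true_and, List.mem_toFinset, List.mem_map] at hP
  obtain ⟨⟨a, ha, rfl⟩, ⟨b, hb, rfl⟩⟩ := hP
  have hy : ix (el a) ∈ Yl := by rwa [ix_el a (hY a ha)]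
  have hw : ix (el b) ∈ Wl := by rwa [ix_el b (hW b hb)]
  have hj : Yl.idxOf (ix (el a)) < 3 := hYl ▸ List.idxOf_lt_length_of_mem hy
  have hk : Wl.idxOf (ix (el b)) < 3 := hWl ▸ List.idxOf_lt_length_of_mem hw
  have hx := ix_lt x
  refine ⟨by simp only [code]; omega, ?_, by simp only [code]; omega⟩
  have e1 : (9 * ix x + 3 * Yl.idxOf (ix (el a)) + Wl.idxOf (ix (el b))) / 9 = ix x := by omega
  have e2 : (9 * ix x + 3 * Yl.idxOf (ix (el a)) + Wl.idxOf (ix (el b))) / 3 % 3 = Yl.idxOf (ix (el a)) := by omega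
  have e3 : (9 * ix x + 3 * Yl.idxOf (ix (el a)) + Wl.idxOf (ix (el b))) % 3 = Wl.idxOf (ix (el b)) := by omega
  have gY : Yl.getD (Yl.idxOf (ix (el a))) 0 = ix (el a) := by
    rw [List.getD_eq_getElem _ _ (List.idxOf_lt_length_of_mem hy), List.getElem_idxOf]
  have gW : Wl.getD (Wl.idxOf (ix (el b))) 0 = ix (el b) := by
    rw [List.getD_eq_getElem _ _ (List.idxOf_lt_length_of_mem hw), List.getElem_idxOf]
  simp only [cellOf, code, e1, e2, e3, gY, gW, el_ix]

/-- **Coding lemma.** An independent cell set inside the box is coded injectively into an `adj`-independent set of naturals `< 108`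
(for a sound table `adj`). [folklore] -/
theorem image_code {adj : ℕ → ℕ} (hadj : adjOK Yl Wl adj = true) {I : Finset (Q × Q × Q)}
    (hI : I ⊆ (univ : Finset Q) ×ˢ ((Yl.map el).toFinset ×ˢ (Wl.map el).toFinset))
    (hind : ∀ P ∈ I, ∀ P' ∈ I, P ≠ P' → cellWord P P' ≠ 1) :
    Set.InjOn (code Yl Wl) I ∧ IndepN adj (I.image (code Yl Wl)) ∧ ∀ a ∈ I.image (code Yl Wl), a < 108 := by
  classical
  have hdec := fun P (hP : P ∈ I) => code_lt_and_cellOf_code hYl hWl hY hW (hI hP)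
  have hinj : Set.InjOn (code Yl Wl) I := fun P hP P' hP' e => by
    rw [← (hdec P hP).2.1, ← (hdec P' hP').2.1, e]
  refine ⟨hinj, fun a ha b hb hab => ?_, fun a ha => ?_⟩
  · obtain ⟨P, hP, rfl⟩ := mem_image.1 ha
    obtain ⟨P', hP', rfl⟩ := mem_image.1 hb
    cases ht : (adj (code Yl Wl P)).testBit (code Yl Wl P')
    · rfl
    · exfalso
      have hPP' : P ≠ P' := fun e => hab (by rw [e])
      obtain ⟨-, hw⟩ := interact_of_adjOK hadj (hdec P hP).1 (hdec P' hP').1 ht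
      rw [(hdec P hP).2.1, (hdec P' hP').2.1] at hw
      rcases hw with hw | hw
      · exact hind P hP P' hP' hPP' hw
      · exact hind P' hP' P hP hPP'.symm hw
  · obtain ⟨P, hP, rfl⟩ := mem_image.1 ha
    exact (hdec P hP).1

/-- **Root glue.** A sound table and "no independent `21`-set of naturals `< 108`" give `BoxOK 20` for the box. [folklore] -/
theorem boxOK_of_root {adj : ℕ → ℕ} (hadj : adjOK Yl Wl adj = true)
    (h : ∀ I : Finset ℕ, IndepN adj I → (∀ a ∈ I, a < 108 ∧ (2 ^ 108 - 1).testBit a = true) → I.card < 21) :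
    BoxOK 20 (univ : Finset Q) (Yl.map el).toFinset (Wl.map el).toFinset := by
  classical
  intro I hI hind
  obtain ⟨hinj, hJ, hlt⟩ := image_code hYl hWl hY hW hadj hI hind
  have := h _ hJ fun a ha => ⟨hlt a ha, by rw [Nat.testBit_two_pow_sub_one]; simpa using hlt a ha⟩
  rw [card_image_of_injOn hinj] at this
  omega

/-- **Orbit glue.** For a sound table, a position pair `j₀ < 9`, "no independent `21`-set avoiding the fibre of `j₀`" (`hA`) and "no
independent `20`-set among the non-neighbours of the code `j₀`" (= the cell `(1, y₀, w₀)`; `hB`) give `BoxOK 20`: an independent cell set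
meeting the fibre is translated (first coordinate, on the right — `cellWord` is invariant) so as to contain `(1, y₀, w₀)`. [folklore] -/
theorem boxOK_of_orbit {adj : ℕ → ℕ} (hadj : adjOK Yl Wl adj = true) (j₀ : ℕ) (hj₀ : j₀ < 9) {PA PB : ℕ}
    (hPA : PA = (2 ^ 108 - 1).ldiff (fibreMask j₀)) (hPB : PB = ((2 ^ 108 - 1).ldiff (adj j₀)).ldiff (2 ^ j₀))
    (hA : ∀ I : Finset ℕ, IndepN adj I → (∀ a ∈ I, a < 108 ∧ PA.testBit a = true) → I.card < 21)
    (hB : ∀ I : Finset ℕ, IndepN adj I → (∀ a ∈ I, a < 108 ∧ PB.testBit a = true) → I.card < 20) :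
    BoxOK 20 (univ : Finset Q) (Yl.map el).toFinset (Wl.map el).toFinset := by
  classical
  intro I hI hind
  subst hPA hPB
  by_cases hmeet : ∃ P ∈ I, code Yl Wl P % 9 = j₀
  · -- translate so that the cell over `j₀` becomes `(1, y₀, w₀)`
    obtain ⟨P₀, hP₀, hP₀j⟩ := hmeet
    let g : Q := P₀.1
    let φ : Q × Q × Q → Q × Q × Q := fun P => (P.1 * g⁻¹, P.2)
    have hφinj : Function.Injective φ := by
      rintro ⟨x, y, w⟩ ⟨x', y', w'⟩ e
      simp only [φ, Prod.mk.injEq, mul_left_inj] at e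
      obtain ⟨rfl, rfl, rfl⟩ := e; rfl
    have hword : ∀ P P' : Q × Q × Q, cellWord (φ P) (φ P') = cellWord P P' := by
      rintro ⟨x, y, w⟩ ⟨x', y', w'⟩
      simp only [φ, cellWord, mul_inv_rev, inv_inv]
      group
    set I' := I.image φ with hI'def
    have hI' : I' ⊆ (univ : Finset Q) ×ˢ ((Yl.map el).toFinset ×ˢ (Wl.map el).toFinset) := by
      intro R hR
      obtain ⟨P, hP, rfl⟩ := mem_image.1 hR
      have := hI hP
      simp only [mem_product, mem_univ, true_and] at this ⊢
      exact this
    have hind' : ∀ R ∈ I', ∀ R' ∈ I', R ≠ R' → cellWord R R' ≠ 1 := by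
      intro R hR R' hR' hne
      obtain ⟨P, hP, rfl⟩ := mem_image.1 hR
      obtain ⟨P', hP', rfl⟩ := mem_image.1 hR'
      rw [hword]
      exact hind P hP P' hP' fun e => hne (by rw [e])
    have hcard : I'.card = I.card := card_image_of_injective I hφinj
    -- the distinguished cell and its code
    set P₁ : Q × Q × Q := φ P₀ with hP₁def
    have hP₁I' : P₁ ∈ I' := mem_image_of_mem φ hP₀
    have hdec := fun P (hP : P ∈ I') => code_lt_and_cellOf_code hYl hWl hY hW (hI' hP)
    have hcode₁ : code Yl Wl P₁ = j₀ := by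
      have h1 : P₁.1 = 1 := by simp [hP₁def, φ, g]
      have hc : code Yl Wl P₁ = 3 * Yl.idxOf (ix P₀.2.1) + Wl.idxOf (ix P₀.2.2) := by
        show 9 * ix P₁.1 + 3 * Yl.idxOf (ix P₁.2.1) + Wl.idxOf (ix P₁.2.2) = _
        rw [h1, ix_one]
        simp [hP₁def, φ]
      have hc0 := (code_lt_and_cellOf_code hYl hWl hY hW (hI hP₀)).2.2
      rw [hc, ← hc0, hP₀j]
    obtain ⟨hinj, hJ, hlt⟩ := image_code hYl hWl hY hW hadj hI' hind'
    -- the rest of `I'` codes into the non-neighbours of `j₀`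
    have hJ' : IndepN adj ((I'.erase P₁).image (code Yl Wl)) := fun a ha b hb hab =>
      hJ a (image_subset_image (erase_subset _ _) ha) b (image_subset_image (erase_subset _ _) hb) hab
    have hsub : ∀ a ∈ (I'.erase P₁).image (code Yl Wl), a < 108 ∧ (((2 ^ 108 - 1).ldiff (adj j₀)).ldiff (2 ^ j₀)).testBit a = true := by
      intro a ha
      obtain ⟨P, hP, rfl⟩ := mem_image.1 ha
      have hPne : P ≠ P₁ := ne_of_mem_erase hP
      have hPI' := mem_of_mem_erase hP
      have ha108 := (hdec P hPI').1
      have hne : code Yl Wl P ≠ j₀ := fun e => hPne (hinj hPI' hP₁I' (e.trans hcode₁.symm))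
      have hnadj : (adj j₀).testBit (code Yl Wl P) = false := by
        rw [← hcode₁]
        exact hJ _ (mem_image_of_mem _ hP₁I') _ (mem_image_of_mem _ hPI') (hcode₁ ▸ hne.symm)
      refine ⟨ha108, ?_⟩
      rw [Nat.testBit_ldiff, Nat.testBit_ldiff, Nat.testBit_two_pow_sub_one, hnadj, Nat.testBit_two_pow]
      simp [ha108, Ne.symm hne]
    have h20 := hB _ hJ' hsub
    rw [card_image_of_injOn (fun P hP P' hP' e => hinj (mem_of_mem_erase hP) (mem_of_mem_erase hP') e),
      card_erase_of_mem hP₁I'] at h20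
    omega
  · -- `I` avoids the fibre
    obtain ⟨hinj, hJ, hlt⟩ := image_code hYl hWl hY hW hadj hI hind
    have hdec := fun P (hP : P ∈ I) => code_lt_and_cellOf_code hYl hWl hY hW (hI hP)
    have hsub : ∀ a ∈ I.image (code Yl Wl), a < 108 ∧ ((2 ^ 108 - 1).ldiff (fibreMask j₀)).testBit a = true := by
      intro a ha
      obtain ⟨P, hP, rfl⟩ := mem_image.1 ha
      have ha108 := (hdec P hP).1
      have hne : code Yl Wl P % 9 ≠ j₀ := fun e => hmeet ⟨P, hP, e⟩
      refine ⟨ha108, ?_⟩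
      rw [Nat.testBit_ldiff, Nat.testBit_two_pow_sub_one, testBit_fibreMask j₀ hj₀ _ ha108]
      simp [ha108, hne]
    have := hA _ hJ hsub
    rw [card_image_of_injOn hinj] at this
    omega

end Coding

/-! ## Symmetries used by the class table: automorphisms -/

/-- Transport of `BoxOK` under a group automorphism applied to all three coordinates (any group). [folklore] -/
theorem BoxOK.of_mulEquiv {G : Type*} [Group G] [Fintype G] [DecidableEq G] {k : ℕ} {Y W : Finset G} (f : G ≃* G)
    (h : BoxOK k univ (Y.image f) (W.image f)) : BoxOK k univ Y W := by
  refine BoxOK.of_map (fun P => (f P.1, f P.2.1, f P.2.2)) ?_ ?_ ?_ h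
  · rintro ⟨x, y, w⟩ ⟨x', y', w'⟩ e
    simp only [Prod.mk.injEq, EmbeddingLike.apply_eq_iff_eq] at e
    obtain ⟨rfl, rfl, rfl⟩ := e; rfl
  · rintro ⟨x, y, w⟩ hP
    simp only [mem_product, mem_univ, true_and, mem_image] at hP ⊢
    exact ⟨⟨y, hP.1, rfl⟩, ⟨w, hP.2, rfl⟩⟩
  · rintro ⟨x, y, w⟩ ⟨x', y', w'⟩ h1
    left
    simp only [cellWord] at h1 ⊢
    rw [← map_inv, ← map_inv, ← map_inv, ← map_mul, ← map_mul, ← map_mul, ← map_mul, ← map_mul] at h1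
    exact (MulEquiv.map_eq_one_iff f).1 h1

/-- The outer automorphism `ψ` of `Dic₃ = QuaternionGroup 3` used by the class table: `a i ↦ a i`, `xa i ↦ xa (i + 1)`
(as a function). [folklore] -/
def psiFun : Q → Q
  | QuaternionGroup.a i => QuaternionGroup.a i
  | QuaternionGroup.xa i => QuaternionGroup.xa (i + 1)

/-- Inverse of `psiFun`. [folklore] -/
def psiInv : Q → Q
  | QuaternionGroup.a i => QuaternionGroup.a i
  | QuaternionGroup.xa i => QuaternionGroup.xa (i - 1)

/-- `ψ` as a group automorphism of `Dic₃` (multiplicativity and the two-sided inverse are finite checks). [folklore] -/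
def psi : Q ≃* Q where
  toFun := psiFun
  invFun := psiInv
  left_inv := by intro q; revert q; decide
  right_inv := by intro q; revert q; decide
  map_mul' := by intro p q; revert p q; decide

/-- The automorphism applied by the class table: identity for `e = 0`, `ψ` otherwise. [folklore] -/
def aut (e : ℕ) : Q ≃* Q := if e = 0 then MulEquiv.refl Q else psi

/-- `aut e` on indices: the table-level description used by `transformOK` agrees with the group map. [folklore] -/
theorem aut_apply (e : ℕ) (q : Q) : aut e q = if e = 0 then q else psiFun q := by
  unfold aut; split_ifs <;> rfl

end Summit.MatrixMultiplication.OmegaCensus.Dic3Box
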